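import Literature.ModelTheory.ExponentialFields.Wilkie1989CurvesTransfer
import Literature.ModelTheory.ExponentialFields.Wilkie1989TwoPoints
import HarnessLib

/-!
# Wilkie 1989, §6: two local facts about zero sets, by transfer (uniqueness on a regular curve; two points with equal abscissa)

Trunk `TranscendEllArithS`, family `periods` (periods.S28): towards the leaf
`Literature.ModelTheory.ExponentialFields.Wilkie1989_expAlgebraicPoints_mem` (`Wilkie1989.lean`;
§6 of A. J. Wilkie, *On the theory of the real exponential field*, Illinois J. Math. 33 (1989),
384–408).

The case analysis on pp. 406–407 of the proof of Theorem 2 works in a model `K` of `T_exp` with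
two facts of calculus imported "by the implicit function theorem and transfer" (p. 406):

* **(3) Uniqueness on a regular curve** (p. 406: "For each `η₁' ∈ (d - ε, d + ε)` there is a unique
  `η̄' = (η₁', …, ηₙ')` in `V ∩ U`"): near a point `x̄` of `V(c₁, …, cₘ) ⊆ K^{m+1}` at which
  `det ∂(c̄)/∂(x₂, …, xₘ₊₁) ≠ 0`, two points of `V` with the same first coordinate coincide
  (`LocalTransfer.uniq_model`; real input: Mathlib's implicit function theorem,
  `LocalTransfer.uniq_real`).
* **Two points with equal abscissa, or points on both sides** (p. 407: "for any `ν > 0` there is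
  `η₁' ∈ [d, d + ν)` and distinct points `ζ̄, ζ̄' ∈ Vⁿˢ(h₁, …, hₙ₋₁)` both having first coordinate
  `η₁'` … arbitrarily close to `η̄`", and the "similar" arguments for `c` and for the points over
  `k`-rational abscissae): near a non-singular zero `x̄` of `q < m + 1` terms `F₁, …, F_q`, for
  every `ε > 0` there are either two distinct zeros of `F̄` within `ε` of `x̄` with the same first
  coordinate, or zeros of `F̄` within `ε` of `x̄` with first coordinate `< x₁` and `> x₁`
  (`LocalTransfer.pairOrSides_model`; real input: `Real.exists_pair_or_two_sides` of
  `Wilkie1989TwoPoints.lean`, `LocalTransfer.pairOrSides_real`).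

Both are written as first-order formulas in the parameters and the point (`uniqF`, `pairOrSidesF`),
realized in lawful structures (`realize_uniqF`, `realize_pairOrSidesF`), proved in `ℝ` and
transferred (`RealExpModel.realize_formula_of_real`).  Distances are the sums of squares
`Σ (zⱼ - xⱼ)²` of p. 388.  All proved; no named facts.

## References

* A. J. Wilkie, *On the theory of the real exponential field*, Illinois J. Math. 33 (1989),
  384–408: §2 p. 388, §6 pp. 406–407.
-/

noncomputable section

open FirstOrder FirstOrder.Language FirstOrder.Language.Structure
open Set Filter
open scoped Topology

namespace Literature.ModelTheory.ExponentialFields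

namespace LocalTransfer

open RealExpModel CurveTransfer SpaceCurve

variable {κ : Type} {m : ℕ}

/-! ### Sums of squares and the sup distance in `ℝⁿ` -/

/-- If `Σ (zⱼ - xⱼ)² < δ²` then `dist z x < δ` (sup distance). [folklore] -/
theorem dist_lt_of_sum_sq_lt {N : ℕ} {z x : Fin N → ℝ} {δ : ℝ} (hδ : 0 < δ)
    (h : ∑ j, (z j - x j) ^ 2 < δ ^ 2) : dist z x < δ := by
  rw [dist_pi_lt_iff hδ]
  intro j
  rw [Real.dist_eq]
  have hj : (z j - x j) ^ 2 < δ ^ 2 :=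
    lt_of_le_of_lt (Finset.single_le_sum (fun i _ => sq_nonneg (z i - x i)) (Finset.mem_univ j)) h
  exact abs_lt_of_sq_lt_sq hj hδ.le

/-- If `dist z x < δ ≤ 1` (sup distance) then `Σ (zⱼ - xⱼ)² ≤ N δ`. [folklore] -/
theorem sum_sq_le_of_dist_lt {N : ℕ} {z x : Fin N → ℝ} {δ : ℝ} (hδ1 : δ ≤ 1)
    (h : dist z x < δ) : ∑ j, (z j - x j) ^ 2 ≤ N * δ := by
  have hδ : 0 ≤ δ := le_trans dist_nonneg h.le
  have hj : ∀ j, (z j - x j) ^ 2 ≤ δ := by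
    intro j
    have h1 : |z j - x j| ≤ δ := by
      rw [← Real.dist_eq]; exact (dist_le_pi_dist z x j).trans h.le
    calc (z j - x j) ^ 2 = |z j - x j| ^ 2 := (sq_abs _).symm
      _ ≤ δ ^ 2 := pow_le_pow_left₀ (abs_nonneg _) h1 2
      _ ≤ δ := by nlinarith
  calc ∑ j, (z j - x j) ^ 2 ≤ ∑ _j : Fin N, δ := Finset.sum_le_sum fun j _ => hj j
    _ = N * δ := by simp

/-! ### (3) Uniqueness on a regular curve -/

section Uniq

/-- **Local uniqueness on a regular curve, over `ℝ`** (implicit function theorem): if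
`x̄ ∈ V(c₁, …, cₘ) ⊆ ℝ^{m+1}` and `det ∂(c̄)/∂(x₂, …, xₘ₊₁)(x̄) ≠ 0` then there is `ε > 0` such that any
two points of `V` within `ε` of `x̄` (in the sense `Σ (zⱼ - xⱼ)² < ε`) with equal first coordinates
are equal. [cite: Wilkie1989, §6, p. 406] -/
theorem uniq_real (c : Fin m → Language.orderedExpRing.Term (κ ⊕ Fin (m + 1))) (a : κ → ℝ)
    (x : Fin (m + 1) → ℝ) (hx : ∀ i, (c i).realize (Sum.elim a x) = 0)
    (hdet : (tailDetT c).realize (Sum.elim a x) ≠ 0) :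
    ∃ ε : ℝ, 0 < ε ∧ ∀ z z' : Fin (m + 1) → ℝ, (∀ i, (c i).realize (Sum.elim a z) = 0) →
      (∀ i, (c i).realize (Sum.elim a z') = 0) → ∑ j, (z j - x j) ^ 2 < ε →
        ∑ j, (z' j - x j) ^ 2 < ε → z 0 = z' 0 → z = z' := by
  set g := sysFn c a with hg_def
  have hg : ∀ i, ContDiff ℝ 1 (g i) := contDiff_sysFn c a
  set u : ℝ × (Fin m → ℝ) := (x 0, Fin.tail x) with hu_def
  have hux : (Fin.cons u.1 u.2 : Fin (m + 1) → ℝ) = x := Fin.cons_self_tail x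
  have hVx : x ∈ zeroLocus g := fun i => hx i
  have hu0 : prodSys g u = 0 := by rw [prodSys_eq_zero_iff, hux]; exact hVx
  have cdf : ContDiffAt ℝ 1 (prodSys g) u := (contDiff_prodSys hg).contDiffAt
  -- invertibility of `∂/∂y` at `u`
  have hdet' : (tailJacobian g x).det ≠ 0 := by rwa [hg_def, det_tailJacobian_sysFn]
  have if₂ : (fderiv ℝ (prodSys g) u ∘L ContinuousLinearMap.inr ℝ ℝ (Fin m → ℝ)).IsInvertible := by
    set L : (Fin m → ℝ) →ₗ[ℝ] (Fin m → ℝ) :=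
      ((fderiv ℝ (prodSys g) u ∘L ContinuousLinearMap.inr ℝ ℝ (Fin m → ℝ)) :
        (Fin m → ℝ) →ₗ[ℝ] (Fin m → ℝ)) with hL
    have hunit :
        IsUnit (LinearMap.toMatrix (Pi.basisFun ℝ (Fin m)) (Pi.basisFun ℝ (Fin m)) L).det := by
      rw [LinearMap.toMatrix_eq_toMatrix', hL, toMatrix'_fderiv_prodSys_inr hg u, hux]
      exact isUnit_iff_ne_zero.2 hdet'
    refine ⟨(LinearEquiv.ofIsUnitDet hunit).toContinuousLinearEquiv, ?_⟩
    ext y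
    rfl
  have pn : (1 : WithTop ℕ∞) ≠ 0 := one_ne_zero
  set ψ := cdf.implicitFunction pn if₂ with hψ
  have hiff : ∀ᶠ v in 𝓝 u, prodSys g v = prodSys g u ↔ ψ v.1 = v.2 :=
    cdf.eventually_apply_eq_iff_implicitFunction pn if₂
  obtain ⟨δ, hδ, hball⟩ := Metric.eventually_nhds_iff_ball.1 hiff
  refine ⟨δ ^ 2, by positivity, fun z z' hz hz' hdz hdz' h0 => ?_⟩
  have key : ∀ w : Fin (m + 1) → ℝ, (∀ i, (c i).realize (Sum.elim a w) = 0) →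
      ∑ j, (w j - x j) ^ 2 < δ ^ 2 → ψ (w 0) = Fin.tail w := by
    intro w hw hdw
    have hmem : ((w 0, Fin.tail w) : ℝ × (Fin m → ℝ)) ∈ Metric.ball u δ := by
      have hd : dist w x < δ := dist_lt_of_sum_sq_lt hδ hdw
      rw [Metric.mem_ball, Prod.dist_eq, hu_def]
      refine max_lt ?_ ?_
      · exact (dist_le_pi_dist w x 0).trans_lt hd
      · rw [dist_pi_lt_iff hδ]
        intro j
        exact (dist_le_pi_dist w x j.succ).trans_lt hd
    have h1 := hball _ hmem
    rw [hu0] at h1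
    have h2 : prodSys g (w 0, Fin.tail w) = 0 := by
      rw [prodSys_eq_zero_iff]
      simp only [Fin.cons_self_tail]
      exact fun i => hw i
    exact h1.1 h2
  have h1 := key z hz hdz
  have h2 := key z' hz' hdz'
  rw [← Fin.cons_self_tail z, ← Fin.cons_self_tail z', ← h1, ← h2, h0]

/-- The context of the local formulas: parameters `κ` and the coordinates of the centre `x̄`. [folklore] -/
abbrev Ctx (κ : Type) (N : ℕ) : Type := κ ⊕ Fin N

/-- A term at a quantified point `z̄` (variables `Sum.inr (l, j)`, `l` the index of the point), the
parameters read in the context. [folklore] -/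
def atVar {N : ℕ} {ι : Type} (l : ι) (s : Language.orderedExpRing.Term (κ ⊕ Fin N)) :
    Language.orderedExpRing.Term ((Ctx κ N ⊕ Fin 1) ⊕ (ι × Fin N)) :=
  s.relabel (Sum.elim (fun p => Sum.inl (Sum.inl (Sum.inl p))) fun j => Sum.inr (l, j))

/-- The squared distance `Σⱼ (z_{l,j} - xⱼ)²` of the quantified point `l` to the centre. [folklore] -/
def sqVar {N : ℕ} {ι : Type} (l : ι) : Language.orderedExpRing.Term ((Ctx κ N ⊕ Fin 1) ⊕ (ι × Fin N)) :=
  ExpTerm.sum fun j : Fin N =>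
    (var (Sum.inr (l, j)) + -var (Sum.inl (Sum.inl (Sum.inr j)))) *
      (var (Sum.inr (l, j)) + -var (Sum.inl (Sum.inl (Sum.inr j))))

variable {M : Type*} [Language.orderedExpRing.Structure M] [Field M] [LinearOrder M]
  [IsStrictOrderedRing M] [LawfulStructure M]

omit [Field M] [LinearOrder M] [IsStrictOrderedRing M] [LawfulStructure M] in
/-- Realization of `atVar`. [folklore] -/
@[simp] theorem realize_atVar {N : ℕ} {ι : Type} (l : ι) (s : Language.orderedExpRing.Term (κ ⊕ Fin N))
    (a : κ → M) (x : Fin N → M) (e : Fin 1 → M) (z : ι × Fin N → M) :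
    (atVar l s).realize (Sum.elim (Sum.elim (Sum.elim a x) e) z) =
      s.realize (Sum.elim a fun j => z (l, j)) := by
  rw [atVar, Term.realize_relabel]
  congr 1
  funext w; rcases w with w | w <;> rfl

omit [IsStrictOrderedRing M] in
/-- Realization of `sqVar`. [folklore] -/
@[simp] theorem realize_sqVar {N : ℕ} {ι : Type} (l : ι) (a : κ → M) (x : Fin N → M) (e : Fin 1 → M)
    (z : ι × Fin N → M) :
    (sqVar (κ := κ) l).realize (Sum.elim (Sum.elim (Sum.elim a x) e) z) =
      ∑ j, (z (l, j) - x j) ^ 2 := by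
  simp [sqVar, sq, sub_eq_add_neg]

/-- **(3) as a first-order formula** in the parameters and the centre `x̄`: if `x̄ ∈ V(c̄)` and
`det ∂(c̄)/∂(x₂, …)(x̄) ≠ 0` then for some `ε > 0`, any two points of `V(c̄)` within `ε` of `x̄`
with equal first coordinates are equal. [cite: Wilkie1989, §6, p. 406] -/
def uniqF (c : Fin m → Language.orderedExpRing.Term (κ ⊕ Fin (m + 1))) :
    Language.orderedExpRing.Formula (Ctx κ (m + 1)) :=
  ((Formula.iInf fun i => ExpFormula.eq ((c i).relabel (Sum.map _root_.id _root_.id)) 0) ⊓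
      (ExpFormula.eq ((tailDetT c).relabel (Sum.map _root_.id _root_.id)) 0).not) ⟹
    Formula.iExs (Fin 1)
      (ExpFormula.lt 0 (var (Sum.inr 0)) ⊓
        Formula.iAlls (Fin 2 × Fin (m + 1))
          (((Formula.iInf fun i => ExpFormula.eq (atVar (0 : Fin 2) (c i)) 0) ⊓
              (Formula.iInf fun i => ExpFormula.eq (atVar (1 : Fin 2) (c i)) 0) ⊓
              ExpFormula.lt (sqVar 0) (var (Sum.inl (Sum.inr 0))) ⊓
              ExpFormula.lt (sqVar 1) (var (Sum.inl (Sum.inr 0))) ⊓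
              ExpFormula.eq (var (Sum.inr ((0 : Fin 2), (0 : Fin (m + 1)))))
                (var (Sum.inr ((1 : Fin 2), (0 : Fin (m + 1)))))) ⟹
            Formula.iInf fun j : Fin (m + 1) =>
              ExpFormula.eq (var (Sum.inr ((0 : Fin 2), j))) (var (Sum.inr ((1 : Fin 2), j)))))

/-- The semantic content of `uniqF`. [folklore] -/
def UniqSem (c : Fin m → Language.orderedExpRing.Term (κ ⊕ Fin (m + 1))) (a : κ → M)
    (x : Fin (m + 1) → M) : Prop :=
  ((∀ i, (c i).realize (Sum.elim a x) = 0) ∧ (tailDetT c).realize (Sum.elim a x) ≠ 0) →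
    ∃ ε : M, 0 < ε ∧ ∀ z z' : Fin (m + 1) → M, (∀ i, (c i).realize (Sum.elim a z) = 0) →
      (∀ i, (c i).realize (Sum.elim a z') = 0) → ∑ j, (z j - x j) ^ 2 < ε →
        ∑ j, (z' j - x j) ^ 2 < ε → z 0 = z' 0 → z = z'

omit [IsStrictOrderedRing M] in
/-- Realization of `uniqF`. [folklore] -/
theorem realize_uniqF (c : Fin m → Language.orderedExpRing.Term (κ ⊕ Fin (m + 1))) (a : κ → M)
    (x : Fin (m + 1) → M) : (uniqF c).Realize (Sum.elim a x) ↔ UniqSem c a x := by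
  have e1 : (Sum.elim a x ∘ Sum.map _root_.id _root_.id : κ ⊕ Fin (m + 1) → M) = Sum.elim a x := by
    funext w; rcases w with w | w <;> rfl
  simp only [uniqF, UniqSem, Formula.realize_imp, Formula.realize_inf, Formula.realize_iInf,
    Formula.realize_iExs, Formula.realize_iAlls, Formula.realize_not, ExpFormula.realize_eq,
    ExpFormula.realize_lt, ExpTerm.realize_zero, Term.realize_relabel, Term.realize_var,
    Sum.elim_inr, Sum.elim_inl, e1, ne_eq]
  refine imp_congr Iff.rfl ?_
  constructor
  · rintro ⟨e, he, H⟩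
    refine ⟨e 0, he, fun z z' hz hz' hdz hdz' h0 => ?_⟩
    have := H (fun p => if p.1 = 0 then z p.2 else z' p.2)
    simp only [realize_atVar, realize_sqVar, Fin.one_eq_zero_iff, OfNat.ofNat_ne_one,
      ↓reduceIte] at this
    exact funext (this ⟨⟨⟨⟨hz, hz'⟩, hdz⟩, hdz'⟩, h0⟩)
  · rintro ⟨ε, hε, H⟩
    refine ⟨fun _ => ε, hε, fun w => ?_⟩
    simp only [realize_atVar, realize_sqVar]
    rintro ⟨⟨⟨⟨hz, hz'⟩, hdz⟩, hdz'⟩, h0⟩ j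
    exact congrFun (H (fun j => w (0, j)) (fun j => w (1, j)) hz hz' hdz hdz' h0) j

/-- **(3) in the models of `T_exp`, by transfer** (Wilkie 1989, p. 406: "This is possible by the
implicit function theorem and transfer"). [cite: Wilkie1989, §6, p. 406] -/
theorem uniq_model (K : Language.Theory.ModelType.{0, 0, 0} realExpTheory)
    (c : Fin m → Language.orderedExpRing.Term (κ ⊕ Fin (m + 1))) (a : κ → K) (x : Fin (m + 1) → K) :
    UniqSem c a x := by
  have hreal : ∀ v : Ctx κ (m + 1) → ℝ, (uniqF c).Realize v := by
    intro v
    rw [← Sum.elim_comp_inl_inr v, realize_uniqF]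
    rintro ⟨hx, hdet⟩
    exact uniq_real c _ _ hx hdet
  have := realize_formula_of_real K (uniqF c) hreal (Sum.elim a x)
  rwa [realize_uniqF] at this

end Uniq

/-! ### Two zeros with equal abscissa, or zeros on both sides -/

section Pair

variable {N q : ℕ}

/-- A linear map from `ℝ^{N+1}` to `ℝ^q` with `q < N + 1` has a non-zero vector in its kernel.
[folklore] -/
theorem exists_ne_zero_map_eq_zero (L : (Fin (N + 1) → ℝ) →ₗ[ℝ] (Fin q → ℝ)) (hq : q < N + 1) :
    ∃ v, v ≠ 0 ∧ L v = 0 := by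
  by_contra h
  push Not at h
  have hinj : Function.Injective L := by
    rw [← LinearMap.ker_eq_bot, Submodule.eq_bot_iff]
    intro v hv
    by_contra hv0
    exact h v hv0 hv
  have := LinearMap.finrank_le_finrank_of_injective hinj
  simp at this
  omega

/-- **Two zeros with equal abscissa or zeros on both sides, over `ℝ`, for exponential terms**: at a
non-singular zero `x̄` of `q < N + 1` terms, for every `ε > 0`, within `Σ (zⱼ - xⱼ)² < ε` of `x̄`
there are two distinct zeros with the same first coordinate, or zeros with first coordinate below
and above `x₁` (`Real.exists_pair_or_two_sides`). [cite: Wilkie1989, §6, p. 407] -/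
theorem pairOrSides_real (F : Fin q → Language.orderedExpRing.Term (κ ⊕ Fin (N + 1))) (a : κ → ℝ)
    (x : Fin (N + 1) → ℝ) (hx : ∀ r, (F r).realize (Sum.elim a x) = 0)
    (hind : LinearIndependent ℝ fun r => grad (F r) a x) (hq : q < N + 1) {ε : ℝ} (hε : 0 < ε) :
    (∃ z z' : Fin (N + 1) → ℝ, (∀ r, (F r).realize (Sum.elim a z) = 0) ∧
      (∀ r, (F r).realize (Sum.elim a z') = 0) ∧ ∑ j, (z j - x j) ^ 2 < ε ∧
        ∑ j, (z' j - x j) ^ 2 < ε ∧ z ≠ z' ∧ z 0 = z' 0) ∨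
    ((∃ z : Fin (N + 1) → ℝ, (∀ r, (F r).realize (Sum.elim a z) = 0) ∧
        ∑ j, (z j - x j) ^ 2 < ε ∧ z 0 < x 0) ∧
      ∃ z : Fin (N + 1) → ℝ, (∀ r, (F r).realize (Sum.elim a z) = 0) ∧
        ∑ j, (z j - x j) ^ 2 < ε ∧ x 0 < z 0) := by
  set H := sysFun F a with hH
  have hHx : H x = 0 := funext fun r => hx r
  have hsurj := range_fderiv_sysFun_eq_top F a x hind
  have hker : ∃ v, v ≠ 0 ∧ fderiv ℝ H x v = 0 :=
    exists_ne_zero_map_eq_zero (fderiv ℝ H x : (Fin (N + 1) → ℝ) →ₗ[ℝ] (Fin q → ℝ)) hq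
  set ε' : ℝ := min 1 (ε / (2 * (N + 1))) with hε'
  have hε'pos : 0 < ε' := lt_min one_pos (by positivity)
  have hsq : ∀ z : Fin (N + 1) → ℝ, dist z x < ε' → ∑ j, (z j - x j) ^ 2 < ε := by
    intro z hz
    have h1 := sum_sq_le_of_dist_lt (min_le_left _ _) hz
    have h2 : ((N + 1 : ℕ) : ℝ) * ε' ≤ ε / 2 := by
      have : ε' ≤ ε / (2 * (N + 1)) := min_le_right _ _
      calc ((N + 1 : ℕ) : ℝ) * ε' ≤ ((N + 1 : ℕ) : ℝ) * (ε / (2 * (N + 1))) := by gcongr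
        _ = ε / 2 := by push_cast; field_simp
    linarith
  have hV : ∀ z : Fin (N + 1) → ℝ, H z = 0 → ∀ r, (F r).realize (Sum.elim a z) = 0 :=
    fun z hz r => congrFun hz r
  rcases Real.exists_pair_or_two_sides H (contDiff_sysFun F a) x hHx hsurj hker
    (ContinuousLinearMap.proj (0 : Fin (N + 1))) hε'pos with
    ⟨z, z', hz, hz', hdz, hdz', hne, h0⟩ | ⟨⟨z, hz, hdz, hlt⟩, ⟨z', hz', hdz', hgt⟩⟩
  · exact Or.inl ⟨z, z', hV z hz, hV z' hz', hsq z hdz, hsq z' hdz', hne, by simpa using h0⟩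
  · exact Or.inr ⟨⟨z, hV z hz, hsq z hdz, by simpa using hlt⟩, ⟨z', hV z' hz', hsq z' hdz',
      by simpa using hgt⟩⟩

variable {M : Type*} [Language.orderedExpRing.Structure M] [Field M] [LinearOrder M]
  [IsStrictOrderedRing M] [LawfulStructure M]

/-- **The formula**: if `x̄` is a zero of `F̄` with some non-zero `q × q` Jacobian minor, then for
every `ε > 0` the alternative of `pairOrSides_real` holds. [cite: Wilkie1989, §6, p. 407] -/
def pairOrSidesF (F : Fin q → Language.orderedExpRing.Term (κ ⊕ Fin (N + 1))) :
    Language.orderedExpRing.Formula (Ctx κ (N + 1)) :=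
  ((Formula.iInf fun r => ExpFormula.eq ((F r).relabel (Sum.map _root_.id _root_.id)) 0) ⊓
      Formula.iSup fun I : Fin q → Fin (N + 1) =>
        (ExpFormula.eq ((minorTerm F I).relabel (Sum.map _root_.id _root_.id)) 0).not) ⟹
    Formula.iAlls (Fin 1)
      (ExpFormula.lt 0 (var (Sum.inr 0)) ⟹
        (Formula.iExs (Fin 2 × Fin (N + 1))
            ((Formula.iInf fun r => ExpFormula.eq (atVar (0 : Fin 2) (F r)) 0) ⊓
              (Formula.iInf fun r => ExpFormula.eq (atVar (1 : Fin 2) (F r)) 0) ⊓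
              ExpFormula.lt (sqVar 0) (var (Sum.inl (Sum.inr 0))) ⊓
              ExpFormula.lt (sqVar 1) (var (Sum.inl (Sum.inr 0))) ⊓
              (Formula.iInf fun j : Fin (N + 1) =>
                ExpFormula.eq (var (Sum.inr ((0 : Fin 2), j))) (var (Sum.inr ((1 : Fin 2), j)))).not ⊓
              ExpFormula.eq (var (Sum.inr ((0 : Fin 2), (0 : Fin (N + 1)))))
                (var (Sum.inr ((1 : Fin 2), (0 : Fin (N + 1)))))) ⊔
          (Formula.iExs (Fin 1 × Fin (N + 1))
              ((Formula.iInf fun r => ExpFormula.eq (atVar (0 : Fin 1) (F r)) 0) ⊓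
                ExpFormula.lt (sqVar 0) (var (Sum.inl (Sum.inr 0))) ⊓
                ExpFormula.lt (var (Sum.inr ((0 : Fin 1), (0 : Fin (N + 1)))))
                  (var (Sum.inl (Sum.inl (Sum.inr 0))))) ⊓
            Formula.iExs (Fin 1 × Fin (N + 1))
              ((Formula.iInf fun r => ExpFormula.eq (atVar (0 : Fin 1) (F r)) 0) ⊓
                ExpFormula.lt (sqVar 0) (var (Sum.inl (Sum.inr 0))) ⊓
                ExpFormula.lt (var (Sum.inl (Sum.inl (Sum.inr 0))))
                  (var (Sum.inr ((0 : Fin 1), (0 : Fin (N + 1)))))))))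

/-- The semantic content of `pairOrSidesF`. [folklore] -/
def PairOrSidesSem (F : Fin q → Language.orderedExpRing.Term (κ ⊕ Fin (N + 1))) (a : κ → M)
    (x : Fin (N + 1) → M) : Prop :=
  ((∀ r, (F r).realize (Sum.elim a x) = 0) ∧
      ∃ I : Fin q → Fin (N + 1), ((Matrix.of fun r => grad (F r) a x).submatrix _root_.id I).det ≠ 0) →
    ∀ ε : M, 0 < ε →
      (∃ z z' : Fin (N + 1) → M, (∀ r, (F r).realize (Sum.elim a z) = 0) ∧
        (∀ r, (F r).realize (Sum.elim a z') = 0) ∧ ∑ j, (z j - x j) ^ 2 < ε ∧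
          ∑ j, (z' j - x j) ^ 2 < ε ∧ z ≠ z' ∧ z 0 = z' 0) ∨
      ((∃ z : Fin (N + 1) → M, (∀ r, (F r).realize (Sum.elim a z) = 0) ∧
          ∑ j, (z j - x j) ^ 2 < ε ∧ z 0 < x 0) ∧
        ∃ z : Fin (N + 1) → M, (∀ r, (F r).realize (Sum.elim a z) = 0) ∧
          ∑ j, (z j - x j) ^ 2 < ε ∧ x 0 < z 0)

omit [IsStrictOrderedRing M] in
/-- Realization of `pairOrSidesF`. [folklore] -/
theorem realize_pairOrSidesF (F : Fin q → Language.orderedExpRing.Term (κ ⊕ Fin (N + 1))) (a : κ → M)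
    (x : Fin (N + 1) → M) : (pairOrSidesF F).Realize (Sum.elim a x) ↔ PairOrSidesSem F a x := by
  have e1 : (Sum.elim a x ∘ Sum.map _root_.id _root_.id : κ ⊕ Fin (N + 1) → M) = Sum.elim a x := by
    funext w; rcases w with w | w <;> rfl
  simp only [pairOrSidesF, PairOrSidesSem, Formula.realize_imp, Formula.realize_inf,
    Formula.realize_sup, Formula.realize_iInf, Formula.realize_iSup, Formula.realize_iExs,
    Formula.realize_iAlls, Formula.realize_not, ExpFormula.realize_eq, ExpFormula.realize_lt,
    ExpTerm.realize_zero, Term.realize_relabel, Term.realize_var, Sum.elim_inr, Sum.elim_inl, e1,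
    realize_minorTerm, ne_eq]
  refine imp_congr Iff.rfl ?_
  constructor
  · intro H ε hε
    rcases H (fun _ => ε) hε with ⟨w, hw⟩ | ⟨⟨w, hw⟩, ⟨w', hw'⟩⟩
    · left
      simp only [realize_atVar, realize_sqVar] at hw
      obtain ⟨⟨⟨⟨⟨hz, hz'⟩, hdz⟩, hdz'⟩, hne⟩, h0⟩ := hw
      exact ⟨fun j => w (0, j), fun j => w (1, j), hz, hz', hdz, hdz',
        fun h => hne fun j => congrFun h j, h0⟩
    · right
      simp only [realize_atVar, realize_sqVar] at hw hw'
      obtain ⟨⟨hz, hdz⟩, hlt⟩ := hw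
      obtain ⟨⟨hz', hdz'⟩, hgt⟩ := hw'
      exact ⟨⟨fun j => w (0, j), hz, hdz, hlt⟩, ⟨fun j => w' (0, j), hz', hdz', hgt⟩⟩
  · intro H e he
    rcases H (e 0) he with ⟨z, z', hz, hz', hdz, hdz', hne, h0⟩ | ⟨⟨z, hz, hdz, hlt⟩, ⟨z', hz', hdz', hgt⟩⟩
    · left
      refine ⟨fun p => if p.1 = 0 then z p.2 else z' p.2, ?_⟩
      simp only [realize_atVar, realize_sqVar, Fin.one_eq_zero_iff, OfNat.ofNat_ne_one,
        ↓reduceIte]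
      exact ⟨⟨⟨⟨⟨hz, hz'⟩, hdz⟩, hdz'⟩, fun h => hne (funext h)⟩, h0⟩
    · right
      refine ⟨⟨fun p => z p.2, ?_⟩, ⟨fun p => z' p.2, ?_⟩⟩
      · simp only [realize_atVar, realize_sqVar]
        exact ⟨⟨hz, hdz⟩, hlt⟩
      · simp only [realize_atVar, realize_sqVar]
        exact ⟨⟨hz', hdz'⟩, hgt⟩

/-- **Two zeros with equal abscissa or zeros on both sides, in the models of `T_exp`, by
transfer** (the calculus behind the case analysis of Wilkie 1989, pp. 406–407). [cite: Wilkie1989, §6, p. 407] -/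
theorem pairOrSides_model (K : Language.Theory.ModelType.{0, 0, 0} realExpTheory)
    (F : Fin q → Language.orderedExpRing.Term (κ ⊕ Fin (N + 1))) (hq : q < N + 1) (a : κ → K)
    (x : Fin (N + 1) → K) : PairOrSidesSem F a x := by
  have hreal : ∀ v : Ctx κ (N + 1) → ℝ, (pairOrSidesF F).Realize v := by
    intro v
    rw [← Sum.elim_comp_inl_inr v, realize_pairOrSidesF]
    rintro ⟨hx, I, hI⟩ ε hε
    have hind : LinearIndependent ℝ fun r => grad (F r) (v ∘ Sum.inl) (v ∘ Sum.inr) :=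
      linearIndependent_rows_of_det_submatrix_ne_zero (Matrix.of fun r => grad (F r) _ _) I hI
    exact pairOrSides_real F _ _ hx hind hq hε
  have := realize_formula_of_real K (pairOrSidesF F) hreal (Sum.elim a x)
  rwa [realize_pairOrSidesF] at this

/-- The hypothesis of `PairOrSidesSem` from membership in the non-singular zero set. [folklore] -/
theorem pairOrSides_of_mem_nonsingularZeroSet (K : Language.Theory.ModelType.{0, 0, 0} realExpTheory)
    {F : Fin q → Language.orderedExpRing.Term (κ ⊕ Fin (N + 1))} (hq : q < N + 1) {a : κ → K}
    {x : Fin (N + 1) → K} (hx : x ∈ nonsingularZeroSet F a) {ε : K} (hε : 0 < ε) :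
    (∃ z z' : Fin (N + 1) → K, z ∈ zeroSet F a ∧ z' ∈ zeroSet F a ∧ ∑ j, (z j - x j) ^ 2 < ε ∧
        ∑ j, (z' j - x j) ^ 2 < ε ∧ z ≠ z' ∧ z 0 = z' 0) ∨
      ((∃ z : Fin (N + 1) → K, z ∈ zeroSet F a ∧ ∑ j, (z j - x j) ^ 2 < ε ∧ z 0 < x 0) ∧
        ∃ z : Fin (N + 1) → K, z ∈ zeroSet F a ∧ ∑ j, (z j - x j) ^ 2 < ε ∧ x 0 < z 0) := by
  obtain ⟨I, -, hI⟩ := exists_det_submatrix_ne_zero_of_linearIndependent_rows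
    (Matrix.of fun r => grad (F r) a x) hx.2
  exact pairOrSides_model K F hq a x ⟨hx.1, I, hI⟩ ε hε

end Pair

end LocalTransfer

end Literature.ModelTheory.ExponentialFields
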